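import Summits.BirchSwinnertonDyer.BirchSwinnertonDyer.Theorems.QuadraticBranchSignedControlPlusEtaNonsurjConjADoorUnit
import Summits.BirchSwinnertonDyer.Rank1Residual.X11b.ChaPairsMinimality
import HarnessLib

/-!
# Route `QuadraticBranchSignedControl` (rung K8, cell `bsd-potss`), residual crux `PlusEtaMainConjectureNonsurj`
# (stmt-BirchSwinnertonDyer-19606): UNIT-ROW RECORDS B — (C1⁺_η) at `p = 5` BY NAME through the unit-row door ∘ door L4 (Hecke) on the
# UNCONGRUENT unit member u5a:41 and the congruent-class unit members c5a:37, c5f:37 (seat `bsd-potss-k8eta-c2` g22; kit j330275 (this seat),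
# j326606/j327196 (k8eta-c2 g21), GRH)

WHAT. Three rank-zero UNIT rows (`ε = +1`, PARI plus-`η` `(λ, μ) = (0, 0)`, `r_an = 0`) whose tautological eigenline on `Cl(ℚ(P)) ⊗ 𝔽₅` is of
eigenvalue-`2` type (`d₂ = 1`: doors L6, L6⁻, L2 void) but of Hecke type TWIST / `V₉` (conjA g13's hecke13 engine: `T_y` acts on the line by
`−Tr ρ̄(y)` resp. `0`, so the line belongs to a companion `ρ̄ ⊗ ε′` resp. to a cubic-twist companion and (c2) for `W` HOLDS): u5a:41
(`W = [1,−1,0,−168507117,841514499916]`, `h(ℚ(P)) = 4800`, `T_y = 0`; kit j330275, this seat — the eig-2 OPEN member of g21's u5a census;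
its siblings: u5a:29 INCONSISTENT (`d₂ = 2`, the one-vector test is inconclusive), u5a:−31 RHO (the class of `ρ̄` occurs: every layer-0
class-group door is void)), c5a:37 (`h = 40`, TWIST) and c5f:37 (`h = 60`, `T_y = 0`) (g21 E5-H-FAM j327196). The unit-row door of this seat
(`EtaConjADoorUnit.quadraticBranchPlusEtaMainConjectureAt_of_heckeEigenHom_of_isUnit`, p715862) makes them (C1⁺_η)@5 BY NAME modulo
`h22 h41 h6273`, the Hecke eigen datum and the PARI unit certificate — no `r_an`/GZK/`L₀`, and on the two congruent-class rows no CL25 transfer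
binder. With records A (u5a:8, 13, 17, 61) the uncongruent class has ELEVEN rows by name (6 prime-`L` rank one, g21; 5 unit, this seat).

HONEST FRAMING (cell `bsd-potss`; FULL-BSD rank ≤ 1 programme, HUMAN RULING D-0036/D-0074): per-row RECORDS, CONDITIONAL on the displayed named
facts (`h22 h41 h6273`) and per-row inputs (the tower clause, the unit certificate, the Hecke-refined eigen datum); class groups / Hecke
eigenvalues / `λ, μ` are GRH resp. numerical values (evidence, not facts); no stub of 19606 is proved by name; the crux stays OPEN; nothing is
booked; `BSD(W,5)` is claimed for no pair. `--supports stmt-BirchSwinnertonDyer-19606`.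

References: [Kobayashi2003] Thm. 2.2 (p. 5), (3.6) (p. 7), §4 (p. 8), Thm. 4.1; [CoatesSujatha2005] §3 (A), Thm. 3.4; [DeoRaySujatha2023] Thm. 3.8;
[Zywina2015] Thm. 1.4 (the `X_ns⁺(5)` family).
-/

set_option autoImplicit false
set_option linter.dupNamespace false
noncomputable section

open scoped Classical nonZeroDivisors

open CongruenceSubgroup NumberField Field WeierstrassCurve
open Literature.NumberTheory.EllipticCurves Literature.NumberTheory.EllipticCurves.ModularForms
  Literature.NumberTheory.EllipticCurves.Rank1Residual Literature.NumberTheory.EllipticCurves.Rank1Residual.Typed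
  Literature.NumberTheory.GaloisRepresentations Literature.NumberTheory.GaloisCohomology Literature.NumberTheory.NumberFields
  Literature.NumberTheory.EllipticCurves.GreenbergVatsal2000 ZpExtension
open Summit.BirchSwinnertonDyer.Rank1Residual Summit.BirchSwinnertonDyer.Rank1Residual.Additive
open Summit.BirchSwinnertonDyer.Rank1Residual.X11b (isElliptic_of_discOf_ne_zero)
open Summit.BirchSwinnertonDyer.BirchSwinnertonDyer.Theorems
open Summit.BirchSwinnertonDyer.BirchSwinnertonDyer.Theorems.EtaConjADoorUnit
  (quadraticBranchPlusEtaMainConjectureAt_of_heckeEigenHom_of_isUnit)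

namespace Summit.BirchSwinnertonDyer.BirchSwinnertonDyer.Theorems.EtaConjADoorUnitRecords

/-- The `5`-partner of u5a:41, `W = [1, -1, 0, -168507117, 841514499916]` (non-CM, `N_W = 1834769475`; `j(W) = j(A)` for the quadratic twist
`A^{(41)}` of `A = [1,−1,1,−4010,98676]` (the `t = 4/5` point of Zywina's `X_ns⁺(5)` family; non-CM, mod-`5` image `C_ns⁺(5)`, NOT `5`-congruent to
any CM row — k8eta-c2 g19 p666083: the domain of v7's hardest stub `stub_etaMC_nonCM_uncongruent`)): `Δ ≠ 0` (kernel). [cite: Zywina2015, Thm. 1.4]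
-/
theorem isElliptic_u5a_41 : (⟨1, (-1), 0, (-168507117), 841514499916⟩ : WeierstrassCurve ℚ).IsElliptic :=
  isElliptic_of_discOf_ne_zero 1 (-1) 0 (-168507117) 841514499916 (by decide +kernel)

/-- **(C1⁺_η) at `p = 5` for every good `a_5 = 0` model `V` of the `5`-twist of the UNCONGRUENT UNIT partner u5a:41** (`W = [1, -1, 0, -168507117,
841514499916]`, non-CM, `N_W = 1834769475`; kit j326613/j330275 (1479+1636 s, GRH): `ε(W) = +1`, PARI plus-`η` `(λ, μ) = (0, 0)` — `L_5⁺(V,η,T)` is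
a UNIT of `Λ` —, `r_an(W) = 0` (`ellanalyticrank`); `h(ℚ(P)) = 4800` (`[30,10,2,2,2,2]`), `h(ℚ(x(P))) = 15`; eigen dimensions `(d₁,d₂,d₃,d₄) =
(0,1,0,1)`; Hecke datum (conjA g13 hecke13 engine, kit j330275): `Tr ρ̄(y) = 2`, `T_y` acts on the tautological line by `c = 0` — verdict `V₉`-TYPE
(`T_y = 0`: the line belongs to a cubic-twist companion, not to `ρ̄`; (c2) for `W` holds) — door L4 (Hecke-refined eigen-test) passes) from the ROW
ALONE — named facts `h22 h41 h6273` ONLY (no `hGZK`, no `r_an`, no `L₀`); displayed: the tower clause, the unit certificate «every `L_5⁺(V,η,T)` is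
a unit», the class-group datum. Instance of `EtaConjADoorUnit.quadraticBranchPlusEtaMainConjectureAt_of_heckeEigenHom_of_isUnit` (k8eta-c2 g22,
p715862). CONDITIONAL; nothing booked. [cite: Kobayashi2003, §4 (p. 8), Thm. 2.2 (p. 5)] [cite: CoatesSujatha2005, §3 (A) and Thm. 3.4] [cite:
Zywina2015, Thm. 1.4] -/
theorem etaMC_unit_u5a_41_5_of_heckeEigenHom
    (h22 : Kobayashi2003.thm22_etaSignedSelmerDual_finite_torsion)
    (h41 : Kobayashi2003.thm41_plusEtaCharIdeal_dvd)
    (h6273 : Kobayashi2003.thm62_63_73_etaColemanPoitouTate) [Fact (5 : ℕ).Prime]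
    (W : WeierstrassCurve ℚ) (hW : W = (⟨1, (-1), 0, (-168507117), 841514499916⟩ : WeierstrassCurve ℚ))
    (V : WeierstrassCurve ℚ) [V.IsElliptic] [V.IsGloballyMinimal] (C : VariableChange ℚ)
    (hC : C • W.quadraticTwist 5 = V)
    (hgood : V.HasGoodReductionAtPrime 5) (hap : V.frobeniusTrace 5 = 0)
    (hns : ¬ ∀ m : ℕ, V.HasSurjectiveModNGaloisRep (5 ^ m : ℕ))
    (hunit : ∀ {N : ℕ} [NeZero N] {f : CuspForm (Gamma0 N) 2}, IsNewformOf V f →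
      ∀ (ϖ : ℚ), (if Even (5 / 2) then (ϖ : ℝ) * V.realPeriodRat = plusPeriod f
          else (ϖ : ℝ) * V.imaginaryPeriodRat = minusPeriod f) →
      ∀ (Lη : IwasawaAlgebra 5), IsQuadraticBranchPlusLFunction f 5 ϖ Lη → IsUnit Lη)
    (hP : haveI : W.IsElliptic := hW ▸ isElliptic_u5a_41
      haveI : NeZero (5 : ℕ) := ⟨by norm_num⟩
      haveI : NumberField (W.divisionField 5) := NumberField.mk
      ∃ P : geomTorsion W ((5 : ℕ) : ℤ), P ≠ 0 ∧
        ∀ K : IntermediateField ℚ (W.divisionField 5),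
          K = IntermediateField.fixedField
            ((MulAction.stabilizer (absoluteGaloisGroup ℚ) P).map (absRestrictNormalHom (W.divisionField 5))) →
        ∀ μ : Additive (ClassGroup (𝓞 K)) →+ ZMod 5,
          (∀ (τ : absoluteGaloisGroup ℚ) (σ : K ≃ₐ[ℚ] K) (a : ℕ),
              (∀ x : K, absRestrictNormalHom (W.divisionField 5) τ (x : W.divisionField 5) =
                ((σ x : K) : W.divisionField 5)) → τ • P = a • P →
              ∀ (I J : (Ideal (𝓞 K))⁰),
                (J : Ideal (𝓞 K)) = (I : Ideal (𝓞 K)).map (AmbiguousClass.intAut σ : 𝓞 K →+* 𝓞 K) →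
                μ (Additive.ofMul (ClassGroup.mk0 J)) = a • μ (Additive.ofMul (ClassGroup.mk0 I))) →
          (∀ (τ τ₁ : absoluteGaloisGroup ℚ) (a a₁ b : ℕ) (Q : geomTorsion W ((5 : ℕ) : ℤ)),
              τ • P = a • P + Q → τ₁ • P = a₁ • P → τ₁ • Q = b • Q → (a₁ : ZMod 5) ≠ (b : ZMod 5) →
              ∀ I : (Ideal (𝓞 K))⁰,
                μ (Additive.ofMul (classGroupNorm K (W.divisionField 5) (ClassGroup.mulEquiv
                  (AmbiguousClass.intAut (absRestrictNormalHom (W.divisionField 5) τ))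
                    (classGroupExtend K (W.divisionField 5) (ClassGroup.mk0 I))))) =
                  (Nat.card ((W.divisionField 5) ≃ₐ[K] (W.divisionField 5)) * a) •
                    μ (Additive.ofMul (ClassGroup.mk0 I))) →
          μ = 0) :
    QuadraticBranchPlusEtaMainConjectureAt V 5 := by
  subst hW
  haveI : (⟨1, (-1), 0, (-168507117), 841514499916⟩ : WeierstrassCurve ℚ).IsElliptic := isElliptic_u5a_41
  haveI : NeZero (5 : ℕ) := ⟨by norm_num⟩
  exact quadraticBranchPlusEtaMainConjectureAt_of_heckeEigenHom_of_isUnit 5 V _ C h22 h41 h6273 (le_refl 5)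
    (by rw [show ((-1 : ℚ) ^ ((5 : ℕ) / 2) * ((5 : ℕ) : ℚ)) = 5 by norm_num]; exact hC) hgood hap hns hP hunit

/-- The `5`-partner of c5a:37, `W = [0, 0, 0, -11807625, 32652190125]` (non-CM, `N_W = 35730900`; `j(W) = j(A)` for the quadratic twist `A^{(37)}`
of `A = [0,0,0,−345,5157]` (non-CM in-table row curve of partner conductor `26100`, `5`-CONGRUENT to a CM row of the crux — k8eta-c2 g8 kernel
certificates; CL25-transfer class, here settled binder-free)): `Δ ≠ 0` (kernel). [cite: Zywina2015, Thm. 1.4] -/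
theorem isElliptic_c5a_37 : (⟨0, 0, 0, (-11807625), 32652190125⟩ : WeierstrassCurve ℚ).IsElliptic :=
  isElliptic_of_discOf_ne_zero 0 0 0 (-11807625) 32652190125 (by decide +kernel)

/-- **(C1⁺_η) at `p = 5` for every good `a_5 = 0` model `V` of the `5`-twist of the CONGRUENT-class UNIT partner c5a:37** (`W = [0, 0, 0, -11807625,
32652190125]`, non-CM, `N_W = 35730900`; kit j326606/j327196 (203+792 s, GRH): `ε(W) = +1`, PARI plus-`η` `(λ, μ) = (0, 0)` — `L_5⁺(V,η,T)` is a
UNIT of `Λ` —, `r_an(W) = 0` (`ellanalyticrank`); `h(ℚ(P)) = 40` (`[10,2,2]`), `h(ℚ(x(P))) = 1`; eigen dimensions `(d₁,d₂,d₃,d₄) = (0,1,0,0)`; Hecke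
datum (conjA g13 hecke13 engine, kit j327196): `Tr ρ̄(y) = 4`, `T_y` acts on the tautological line by `c = 1` — verdict TWIST-TYPE (`T_y = −Tr`: the
line belongs to `ρ̄ ⊗ ε′`, not to `ρ̄`; (c2) for `W` holds) — door L4 (Hecke-refined eigen-test) passes) from the ROW ALONE — named facts `h22 h41
h6273` ONLY (no `hGZK`, no `r_an`, no `L₀`); displayed: the tower clause, the unit certificate «every `L_5⁺(V,η,T)` is a unit», the class-group
datum. Instance of `EtaConjADoorUnit.quadraticBranchPlusEtaMainConjectureAt_of_heckeEigenHom_of_isUnit` (k8eta-c2 g22, p715862). CONDITIONAL;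
nothing booked. [cite: Kobayashi2003, §4 (p. 8), Thm. 2.2 (p. 5)] [cite: CoatesSujatha2005, §3 (A) and Thm. 3.4] [cite: Zywina2015, Thm. 1.4] -/
theorem etaMC_unit_c5a_37_5_of_heckeEigenHom
    (h22 : Kobayashi2003.thm22_etaSignedSelmerDual_finite_torsion)
    (h41 : Kobayashi2003.thm41_plusEtaCharIdeal_dvd)
    (h6273 : Kobayashi2003.thm62_63_73_etaColemanPoitouTate) [Fact (5 : ℕ).Prime]
    (W : WeierstrassCurve ℚ) (hW : W = (⟨0, 0, 0, (-11807625), 32652190125⟩ : WeierstrassCurve ℚ))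
    (V : WeierstrassCurve ℚ) [V.IsElliptic] [V.IsGloballyMinimal] (C : VariableChange ℚ)
    (hC : C • W.quadraticTwist 5 = V)
    (hgood : V.HasGoodReductionAtPrime 5) (hap : V.frobeniusTrace 5 = 0)
    (hns : ¬ ∀ m : ℕ, V.HasSurjectiveModNGaloisRep (5 ^ m : ℕ))
    (hunit : ∀ {N : ℕ} [NeZero N] {f : CuspForm (Gamma0 N) 2}, IsNewformOf V f →
      ∀ (ϖ : ℚ), (if Even (5 / 2) then (ϖ : ℝ) * V.realPeriodRat = plusPeriod f
          else (ϖ : ℝ) * V.imaginaryPeriodRat = minusPeriod f) →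
      ∀ (Lη : IwasawaAlgebra 5), IsQuadraticBranchPlusLFunction f 5 ϖ Lη → IsUnit Lη)
    (hP : haveI : W.IsElliptic := hW ▸ isElliptic_c5a_37
      haveI : NeZero (5 : ℕ) := ⟨by norm_num⟩
      haveI : NumberField (W.divisionField 5) := NumberField.mk
      ∃ P : geomTorsion W ((5 : ℕ) : ℤ), P ≠ 0 ∧
        ∀ K : IntermediateField ℚ (W.divisionField 5),
          K = IntermediateField.fixedField
            ((MulAction.stabilizer (absoluteGaloisGroup ℚ) P).map (absRestrictNormalHom (W.divisionField 5))) →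
        ∀ μ : Additive (ClassGroup (𝓞 K)) →+ ZMod 5,
          (∀ (τ : absoluteGaloisGroup ℚ) (σ : K ≃ₐ[ℚ] K) (a : ℕ),
              (∀ x : K, absRestrictNormalHom (W.divisionField 5) τ (x : W.divisionField 5) =
                ((σ x : K) : W.divisionField 5)) → τ • P = a • P →
              ∀ (I J : (Ideal (𝓞 K))⁰),
                (J : Ideal (𝓞 K)) = (I : Ideal (𝓞 K)).map (AmbiguousClass.intAut σ : 𝓞 K →+* 𝓞 K) →
                μ (Additive.ofMul (ClassGroup.mk0 J)) = a • μ (Additive.ofMul (ClassGroup.mk0 I))) →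
          (∀ (τ τ₁ : absoluteGaloisGroup ℚ) (a a₁ b : ℕ) (Q : geomTorsion W ((5 : ℕ) : ℤ)),
              τ • P = a • P + Q → τ₁ • P = a₁ • P → τ₁ • Q = b • Q → (a₁ : ZMod 5) ≠ (b : ZMod 5) →
              ∀ I : (Ideal (𝓞 K))⁰,
                μ (Additive.ofMul (classGroupNorm K (W.divisionField 5) (ClassGroup.mulEquiv
                  (AmbiguousClass.intAut (absRestrictNormalHom (W.divisionField 5) τ))
                    (classGroupExtend K (W.divisionField 5) (ClassGroup.mk0 I))))) =
                  (Nat.card ((W.divisionField 5) ≃ₐ[K] (W.divisionField 5)) * a) •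
                    μ (Additive.ofMul (ClassGroup.mk0 I))) →
          μ = 0) :
    QuadraticBranchPlusEtaMainConjectureAt V 5 := by
  subst hW
  haveI : (⟨0, 0, 0, (-11807625), 32652190125⟩ : WeierstrassCurve ℚ).IsElliptic := isElliptic_c5a_37
  haveI : NeZero (5 : ℕ) := ⟨by norm_num⟩
  exact quadraticBranchPlusEtaMainConjectureAt_of_heckeEigenHom_of_isUnit 5 V _ C h22 h41 h6273 (le_refl 5)
    (by rw [show ((-1 : ℚ) ^ ((5 : ℕ) / 2) * ((5 : ℕ) : ℚ)) = 5 by norm_num]; exact hC) hgood hap hns hP hunit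

/-- The `5`-partner of c5f:37, `W = [0, 0, 1, -28749000, 2293631156]` (non-CM, `N_W = 467889975`; `j(W) = j(A)` for the quadratic twist `A^{(37)}`
of `A = [0,0,1,−7581,−311906]`-class (non-CM in-table row curve of partner conductor `341775`, `5`-CONGRUENT to a CM row — k8eta-c2 g8;
CL25-transfer class, here settled binder-free)): `Δ ≠ 0` (kernel). [cite: Zywina2015, Thm. 1.4] -/
theorem isElliptic_c5f_37 : (⟨0, 0, 1, (-28749000), 2293631156⟩ : WeierstrassCurve ℚ).IsElliptic :=
  isElliptic_of_discOf_ne_zero 0 0 1 (-28749000) 2293631156 (by decide +kernel)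

/-- **(C1⁺_η) at `p = 5` for every good `a_5 = 0` model `V` of the `5`-twist of the CONGRUENT-class UNIT partner c5f:37** (`W = [0, 0, 1, -28749000,
2293631156]`, non-CM, `N_W = 467889975`; kit j326606/j327196 (534+1099 s, GRH): `ε(W) = +1`, PARI plus-`η` `(λ, μ) = (0, 0)` — `L_5⁺(V,η,T)` is a
UNIT of `Λ` —, `r_an(W) = 0` (`ellanalyticrank`); `h(ℚ(P)) = 60` (`[30,2]`), `h(ℚ(x(P))) = 3`; eigen dimensions `(d₁,d₂,d₃,d₄) = (0,1,0,0)`; Hecke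
datum (conjA g13 hecke13 engine, kit j327196): `Tr ρ̄(y) = 1`, `T_y` acts on the tautological line by `c = 0` — verdict `V₉`-TYPE (`T_y = 0`: the
line belongs to a cubic-twist companion, not to `ρ̄`; (c2) for `W` holds) — door L4 (Hecke-refined eigen-test) passes) from the ROW ALONE — named
facts `h22 h41 h6273` ONLY (no `hGZK`, no `r_an`, no `L₀`); displayed: the tower clause, the unit certificate «every `L_5⁺(V,η,T)` is a unit», the
class-group datum. Instance of `EtaConjADoorUnit.quadraticBranchPlusEtaMainConjectureAt_of_heckeEigenHom_of_isUnit` (k8eta-c2 g22, p715862).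
CONDITIONAL; nothing booked. [cite: Kobayashi2003, §4 (p. 8), Thm. 2.2 (p. 5)] [cite: CoatesSujatha2005, §3 (A) and Thm. 3.4] [cite: Zywina2015,
Thm. 1.4] -/
theorem etaMC_unit_c5f_37_5_of_heckeEigenHom
    (h22 : Kobayashi2003.thm22_etaSignedSelmerDual_finite_torsion)
    (h41 : Kobayashi2003.thm41_plusEtaCharIdeal_dvd)
    (h6273 : Kobayashi2003.thm62_63_73_etaColemanPoitouTate) [Fact (5 : ℕ).Prime]
    (W : WeierstrassCurve ℚ) (hW : W = (⟨0, 0, 1, (-28749000), 2293631156⟩ : WeierstrassCurve ℚ))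
    (V : WeierstrassCurve ℚ) [V.IsElliptic] [V.IsGloballyMinimal] (C : VariableChange ℚ)
    (hC : C • W.quadraticTwist 5 = V)
    (hgood : V.HasGoodReductionAtPrime 5) (hap : V.frobeniusTrace 5 = 0)
    (hns : ¬ ∀ m : ℕ, V.HasSurjectiveModNGaloisRep (5 ^ m : ℕ))
    (hunit : ∀ {N : ℕ} [NeZero N] {f : CuspForm (Gamma0 N) 2}, IsNewformOf V f →
      ∀ (ϖ : ℚ), (if Even (5 / 2) then (ϖ : ℝ) * V.realPeriodRat = plusPeriod f
          else (ϖ : ℝ) * V.imaginaryPeriodRat = minusPeriod f) →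
      ∀ (Lη : IwasawaAlgebra 5), IsQuadraticBranchPlusLFunction f 5 ϖ Lη → IsUnit Lη)
    (hP : haveI : W.IsElliptic := hW ▸ isElliptic_c5f_37
      haveI : NeZero (5 : ℕ) := ⟨by norm_num⟩
      haveI : NumberField (W.divisionField 5) := NumberField.mk
      ∃ P : geomTorsion W ((5 : ℕ) : ℤ), P ≠ 0 ∧
        ∀ K : IntermediateField ℚ (W.divisionField 5),
          K = IntermediateField.fixedField
            ((MulAction.stabilizer (absoluteGaloisGroup ℚ) P).map (absRestrictNormalHom (W.divisionField 5))) →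
        ∀ μ : Additive (ClassGroup (𝓞 K)) →+ ZMod 5,
          (∀ (τ : absoluteGaloisGroup ℚ) (σ : K ≃ₐ[ℚ] K) (a : ℕ),
              (∀ x : K, absRestrictNormalHom (W.divisionField 5) τ (x : W.divisionField 5) =
                ((σ x : K) : W.divisionField 5)) → τ • P = a • P →
              ∀ (I J : (Ideal (𝓞 K))⁰),
                (J : Ideal (𝓞 K)) = (I : Ideal (𝓞 K)).map (AmbiguousClass.intAut σ : 𝓞 K →+* 𝓞 K) →
                μ (Additive.ofMul (ClassGroup.mk0 J)) = a • μ (Additive.ofMul (ClassGroup.mk0 I))) →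
          (∀ (τ τ₁ : absoluteGaloisGroup ℚ) (a a₁ b : ℕ) (Q : geomTorsion W ((5 : ℕ) : ℤ)),
              τ • P = a • P + Q → τ₁ • P = a₁ • P → τ₁ • Q = b • Q → (a₁ : ZMod 5) ≠ (b : ZMod 5) →
              ∀ I : (Ideal (𝓞 K))⁰,
                μ (Additive.ofMul (classGroupNorm K (W.divisionField 5) (ClassGroup.mulEquiv
                  (AmbiguousClass.intAut (absRestrictNormalHom (W.divisionField 5) τ))
                    (classGroupExtend K (W.divisionField 5) (ClassGroup.mk0 I))))) =
                  (Nat.card ((W.divisionField 5) ≃ₐ[K] (W.divisionField 5)) * a) •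
                    μ (Additive.ofMul (ClassGroup.mk0 I))) →
          μ = 0) :
    QuadraticBranchPlusEtaMainConjectureAt V 5 := by
  subst hW
  haveI : (⟨0, 0, 1, (-28749000), 2293631156⟩ : WeierstrassCurve ℚ).IsElliptic := isElliptic_c5f_37
  haveI : NeZero (5 : ℕ) := ⟨by norm_num⟩
  exact quadraticBranchPlusEtaMainConjectureAt_of_heckeEigenHom_of_isUnit 5 V _ C h22 h41 h6273 (le_refl 5)
    (by rw [show ((-1 : ℚ) ^ ((5 : ℕ) / 2) * ((5 : ℕ) : ℚ)) = 5 by norm_num]; exact hC) hgood hap hns hP hunit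

end Summit.BirchSwinnertonDyer.BirchSwinnertonDyer.Theorems.EtaConjADoorUnitRecords

end
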